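import Literature.RepresentationTheory.Kovacevic2021.SU21RelativeCochainsDegreeOne
import HarnessLib

/-!
# Kovačević's `SU(2,1)`-modules: `H⁰` and `H¹(𝔤, 𝔨; V)` for the six cohomological modules — the degree `≤ 1`
# columns of Borel–Wallach VI 4.11 at `n = 2`, on the tree's Chevalley–Eilenberg carriers

Topic `RepresentationTheory/Kovacevic2021`; namespace `Literature.RepresentationTheory.Kovacevic2021`.
Theorems only (and no named fact); sequel to `SU21RelativeCochainsDegreeOne`, which identifies the relative
cochains `C⁰(𝔤, 𝔨; V) ≅ {𝔨-highest-weight vectors of type (1,0)}` and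
`C¹(𝔤, 𝔨; V) ≅ {hw vectors of type (2,3)} × {hw vectors of type (2,-3)}` of the Lie module `V = 𝒟.V` of a
`K`-type datum `𝒟` [Kovacevic2021, §3] over `𝔤 = 𝔤𝔩(3,ℂ) ⊃ 𝔨 = 𝔤𝔩(2) ⊕ 𝔤𝔩(1)`.

Borel–Wallach [BorelWallach2000, VI Thm 4.11 (2), (3), `n = 2`]: among the six cohomological
`(𝔤, K)`-modules `J_{0,0}, J_{1,0}, J_{0,1}, D_0, D_1, D_2` of `SU(2,1)` exactly `J_{1,0}` and `J_{0,1}` have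
`H¹ ≠ 0`, each one-dimensional ("`H^q(J_{ij}) = ℂ` if `q = i + j + 2l`"; "`H^q(D_i) = 0` if `q ≠ n`").

## What is proved

* generic, for any subcomplex `S` of a Chevalley–Eilenberg complex: if `d` vanishes on `S_q` and on `S_{q+1}`
  then the class map `S_{q+1} → H^{q+1}(S)` is bijective (`bijective_toCohomology_of_closed`,
  `finrank_cohomology_succ_of_closed`, `finrank_cohomology_zero_of_closed`) — the degree-local form of [BorelWallach2000, II Prop. 3.1 (b)]
  (the all-degree form is `BorelWallach2000/RelativeCohomologyCasimirCriterion`);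
* for any datum: `C¹ = 0` unless `(2,3) ∈ S` or `(2,-3) ∈ S` (`relCochain_one_eq_bot`), `C⁰ = 0` unless
  `(1,0) ∈ S` (`relCochain_zero_eq_bot`); `H¹ = 0` if `C¹ = 0`, and `dim H¹ = dim C¹` if `C⁰ = 0` and `d = 0`
  on `C¹` (`finrank_relCohomology_one_eq_zero`, `finrank_relCohomology_one_eq`);
* **the six modules** (`trivialMod = U(0) = J_{0,0}`, `holDS = D₂`, `antiholDS = D₀`, `midDS = D₁`,
  `ladderPlus = Z(3) = J_{1,0}`, `ladderMinus = Z(-3) = J_{0,1}` of `SU21ModulesFromKTypes`):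
  `dim C¹ = 0` and **`H¹(𝔤, 𝔨; V) = 0`** for `U(0)`, `D₂`, `D₀`, `D₁`
  (`finrank_relCohomology_one_trivialMod/holDS/antiholDS/midDS`); for the two ladder modules `C⁰ = 0`,
  `dim C¹ = 1`, every relative `1`-cochain is closed (`d_eq_zero_of_mem_relCochain_one_ladderPlus`,
  `…_ladderMinus` — the cochain is `y ↦ c (y₀₂ u¹_{2,3} - y₁₂ u²_{2,3})` resp.
  `y ↦ c (y₂₁ u¹_{2,-3} + y₂₀ u²_{2,-3})`, and `(df)(x,y) = x·f(y) - y·f(x) - f([x,y])` vanishes by the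
  arrow data `A_{2,3} = -1`, `B = C = D = 0` resp. `B_{2,-3} = -1`, `A = C = D = 0`), hence
  **`dim H¹(𝔤, 𝔨; J_{1,0}) = dim H¹(𝔤, 𝔨; J_{0,1}) = 1`** (`finrank_relCohomology_one_ladderPlus`,
  `finrank_relCohomology_one_ladderMinus`); and the degree-`0` column: `dim H⁰(𝔤, 𝔨; U(0)) = 1`, `H⁰ = 0` for the
  other five (`finrank_relCohomology_zero_trivialMod`, `finrank_relCohomology_zero_five`).

NOT here: `H^q` for `q ≥ 2` (needs `C^q(𝔤,𝔨;V) = Hom_𝔨(Λ^q 𝔭, V)` in degrees `≥ 2`); the identification of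
the six algebraic modules with Borel–Wallach's analytic `J_{ij}`, `D_i` beyond their `K`-type data.

## References

* A. Borel, N. Wallach (2000), I §1.2 p. 8; II Prop. 3.1 p. 36; VI Thm 4.11 pp. 132–133 (held chunks
  p0059–p0062, p0168–p0169). [BorelWallach2000]
* D. Kovačević, Acta Math. Spalatensia 1 (2021) 105–125, §3 Thm 1, Thm 3, §4. [Kovacevic2021]
* D. A. Vogan, G. J. Zuckerman, Compositio Math. 53 (1984) 51–90 (the general classification, of which
  this is the rank-one, degree-one instance). [VoganZuckerman1984]
-/

noncomputable section

open Finsupp Module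
open Literature.Algebra.Lie Literature.Algebra.Lie.ChevalleyEilenberg

namespace Literature.RepresentationTheory.Kovacevic2021

-- Mathlib idiom (Mathlib/Algebra/Lie/OfAssociative.lean): bracket on `Matrix`/`Module.End` = commutator.
attribute [local instance 100] LieRing.ofAssociativeRing

/-! ### A degree-local form of "no coboundaries and all cochains closed ⇒ `H^{q+1} = C^{q+1}`" -/

section Generic

variable {R : Type*} [CommRing R] {L : Type*} [LieRing L] [LieAlgebra R L]
  {M : Type*} [AddCommGroup M] [Module R M] [LieRingModule L M] [LieModule R L M]

/-- If a subcomplex has no coboundaries in degree `q` and every `q`-cochain of it is closed, the class map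
`S_q → H^q(S)` is bijective. [cite: BorelWallach2000, II Prop. 3.1 (b)] -/
theorem bijective_toCohomology_of_closed (S : Subcomplex R L M) (q : ℕ) (hB : S.coboundaries q = ⊥)
    (hq : ∀ f ∈ S.carrier q, d R L M q f = 0) :
    Function.Bijective (S.toCohomology q ∘ₗ
      Submodule.inclusion (fun f hf => (S.mem_cocycles_iff q f).2 ⟨hf, hq f hf⟩ : S.carrier q ≤ S.cocycles q)) := by
  refine ⟨?_, fun x => ?_⟩
  · rw [injective_iff_map_eq_zero]
    intro f hf
    rw [LinearMap.comp_apply, S.toCohomology_eq_zero_iff, hB, Submodule.mem_bot, Submodule.coe_inclusion] at hf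
    exact Subtype.ext hf
  · obtain ⟨z, rfl⟩ := S.toCohomology_surjective q x
    exact ⟨⟨(z : Cochain R L M q), ((S.mem_cocycles_iff q _).1 z.2).1⟩, congrArg (S.toCohomology q) (Subtype.ext rfl)⟩

/-- … hence `dim H^q(S) = dim S_q`. [cite: BorelWallach2000, II Prop. 3.1 (b)] -/
theorem finrank_cohomology_of_closed (S : Subcomplex R L M) (q : ℕ) (hB : S.coboundaries q = ⊥)
    (hq : ∀ f ∈ S.carrier q, d R L M q f = 0) :
    Module.finrank R (S.Cohomology q) = Module.finrank R (S.carrier q) :=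
  (LinearEquiv.ofBijective _ (bijective_toCohomology_of_closed S q hB hq)).finrank_eq.symm

/-- Degree `q + 1`: no coboundaries as soon as `d` vanishes on `S_q`. [cite: BorelWallach2000, II Prop. 3.1 (b)] -/
theorem finrank_cohomology_succ_of_closed (S : Subcomplex R L M) (q : ℕ)
    (hq : ∀ g ∈ S.carrier q, d R L M q g = 0) (hq1 : ∀ f ∈ S.carrier (q + 1), d R L M (q + 1) f = 0) :
    Module.finrank R (S.Cohomology (q + 1)) = Module.finrank R (S.carrier (q + 1)) := by
  refine finrank_cohomology_of_closed S (q + 1) ?_ hq1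
  rw [eq_bot_iff]
  intro f hf
  obtain ⟨g, hg, rfl⟩ := (S.mem_coboundaries_succ_iff q f).1 hf
  rw [Submodule.mem_bot]
  exact hq g hg

/-- Degree `0`: there are no coboundaries, so `dim H⁰(S) = dim S₀` as soon as every `0`-cochain of `S` is closed
(`L`-invariant). [cite: BorelWallach2000, I §1.2 (3)] -/
theorem finrank_cohomology_zero_of_closed (S : Subcomplex R L M) (h0 : ∀ f ∈ S.carrier 0, d R L M 0 f = 0) :
    Module.finrank R (S.Cohomology 0) = Module.finrank R (S.carrier 0) :=
  finrank_cohomology_of_closed S 0 rfl h0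

end Generic

namespace SU21Datum

variable (𝒟 : SU21Datum)

/-! ### Vanishing criteria for `C⁰`, `C¹` and `H¹` (any datum) -/

/-- `C⁰(𝔤, 𝔨; V) = 0` if `V_{1,0}` is not a `K`-type of `V`. [cite: BorelWallach2000, VI Thm 4.11 (11)] -/
theorem relCochain_zero_eq_bot (h : ((1 : ℤ), (0 : ℤ)) ∉ 𝒟.S) : 𝒟.relCochain 0 = ⊥ := by
  rw [Submodule.eq_bot_iff]
  intro f hf
  have hv := (𝒟.mem_relCochain_zero_iff f).1 hf
  rw [hwSpace_eq_span, vec_of_not_mem 1 h, Submodule.span_zero_singleton, Submodule.mem_bot] at hv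
  refine AlternatingMap.ext fun v => ?_
  rw [show v = ![] from Subsingleton.elim _ _, hv, AlternatingMap.zero_apply]

/-- `C¹(𝔤, 𝔨; V) = 0` if neither `V_{2,3}` nor `V_{2,-3}` is a `K`-type of `V`. [cite: BorelWallach2000, VI Thm 4.11 (11)] -/
theorem relCochain_one_eq_bot (h₁ : ((2 : ℤ), (3 : ℤ)) ∉ 𝒟.S) (h₂ : ((2 : ℤ), (-3 : ℤ)) ∉ 𝒟.S) :
    𝒟.relCochain 1 = ⊥ := by
  rw [Submodule.eq_bot_iff]
  intro f hf
  rw [eq_pairCochain hf]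
  have e1 : f ![E 0 2] = 0 := by
    have h := apply_E02_mem_hwSpace hf
    rwa [hwSpace_eq_span, vec_of_not_mem 1 h₁, Submodule.span_zero_singleton, Submodule.mem_bot] at h
  have e2 : f ![E 2 1] = 0 := by
    have h := apply_E21_mem_hwSpace hf
    rwa [hwSpace_eq_span, vec_of_not_mem 1 h₂, Submodule.span_zero_singleton, Submodule.mem_bot] at h
  rw [e1, e2]
  refine AlternatingMap.ext fun v => ?_
  simp [pairMap_apply]


/-! ### `H¹(𝔤, 𝔨; V)` from `C⁰` and `C¹` -/

/-- If `C¹(𝔤, 𝔨; V) = 0` then `H¹(𝔤, 𝔨; V) = 0`. [cite: BorelWallach2000, I §1.2 (1)] -/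
theorem finrank_relCohomology_one_eq_zero (h : 𝒟.relCochain 1 = ⊥) :
    finrank ℂ (relCohomology ℂ gl3 𝒟.V kSub 1) = 0 := by
  haveI : Subsingleton ((Subcomplex.rel ℂ gl3 𝒟.V kSub).cocycles 1) := by
    refine ⟨fun a b => Subtype.ext ?_⟩
    have ha : (a : Cochain ℂ gl3 𝒟.V 1) ∈ 𝒟.relCochain 1 := ((Subcomplex.mem_cocycles_iff _ 1 _).1 a.2).1
    have hb : (b : Cochain ℂ gl3 𝒟.V 1) ∈ 𝒟.relCochain 1 := ((Subcomplex.mem_cocycles_iff _ 1 _).1 b.2).1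
    rw [h, Submodule.mem_bot] at ha hb
    rw [ha, hb]
  haveI : Subsingleton (relCohomology ℂ gl3 𝒟.V kSub 1) :=
    ((Subcomplex.rel ℂ gl3 𝒟.V kSub).toCohomology_surjective 1).subsingleton
  exact Module.finrank_zero_of_subsingleton

/-- **If `C⁰(𝔤, 𝔨; V) = 0` and `d` vanishes on `C¹(𝔤, 𝔨; V)`, then `H¹(𝔤, 𝔨; V) = C¹(𝔤, 𝔨; V)`** (no
coboundaries, every cochain closed). [cite: BorelWallach2000, II Prop. 3.1 (b)] -/
theorem finrank_relCohomology_one_eq (h0 : 𝒟.relCochain 0 = ⊥)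
    (hd : ∀ f ∈ 𝒟.relCochain 1, d ℂ gl3 𝒟.V 1 f = 0) :
    finrank ℂ (relCohomology ℂ gl3 𝒟.V kSub 1) = finrank ℂ (𝒟.relCochain 1) :=
  finrank_cohomology_succ_of_closed (Subcomplex.rel ℂ gl3 𝒟.V kSub) 0
    (fun g hg => by
      have hg' : g ∈ 𝒟.relCochain 0 := hg
      rw [h0, Submodule.mem_bot] at hg'
      rw [hg', map_zero])
    hd


/-! ### `H⁰(𝔤, 𝔨; V)` -/

/-- `H⁰(𝔤, 𝔨; V) = 0` if `C⁰(𝔤, 𝔨; V) = 0`, i.e. if `V_{1,0}` is not a `K`-type. [cite: BorelWallach2000, I §1.2 (3)] -/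
theorem finrank_relCohomology_zero_eq_zero (h : 𝒟.relCochain 0 = ⊥) :
    finrank ℂ (relCohomology ℂ gl3 𝒟.V kSub 0) = 0 := by
  have hd : ∀ f ∈ (Subcomplex.rel ℂ gl3 𝒟.V kSub).carrier 0, d ℂ gl3 𝒟.V 0 f = 0 := fun f hf => by
    have hf' : f ∈ 𝒟.relCochain 0 := hf
    rw [h, Submodule.mem_bot] at hf'
    rw [hf', map_zero]
  have e := finrank_cohomology_zero_of_closed (Subcomplex.rel ℂ gl3 𝒟.V kSub) hd
  have e' : finrank ℂ (𝒟.relCochain 0) = 0 := by rw [h, finrank_bot]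
  exact e.trans e'


/-! ### The six cohomological modules of `SU(2,1)` -/

section Six

/-- a `2`-cochain only sees `(v 0, v 1)` [folklore] -/
private theorem cochain_two_apply_eq {𝒟 : SU21Datum} (g : Cochain ℂ gl3 𝒟.V 2) (v : Fin 2 → gl3) :
    g v = g ![v 0, v 1] := by
  congr 1
  ext i
  fin_cases i <;> rfl

/-- `K`-type bookkeeping for the six modules: which of `V_{1,0}`, `V_{2,3}`, `V_{2,-3}` occur.
[cite: Kovacevic2021, §4] [cite: BorelWallach2000, VI 4.8, Thm 4.11 (9)] -/
theorem six_Ktypes :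
    (((1 : ℤ), (0 : ℤ)) ∈ trivialMod.S ∧ ((2 : ℤ), (3 : ℤ)) ∉ trivialMod.S ∧ ((2 : ℤ), (-3 : ℤ)) ∉ trivialMod.S) ∧
    (((1 : ℤ), (0 : ℤ)) ∉ holDS.S ∧ ((2 : ℤ), (3 : ℤ)) ∉ holDS.S ∧ ((2 : ℤ), (-3 : ℤ)) ∉ holDS.S) ∧
    (((1 : ℤ), (0 : ℤ)) ∉ antiholDS.S ∧ ((2 : ℤ), (3 : ℤ)) ∉ antiholDS.S ∧ ((2 : ℤ), (-3 : ℤ)) ∉ antiholDS.S) ∧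
    (((1 : ℤ), (0 : ℤ)) ∉ midDS.S ∧ ((2 : ℤ), (3 : ℤ)) ∉ midDS.S ∧ ((2 : ℤ), (-3 : ℤ)) ∉ midDS.S) ∧
    (((1 : ℤ), (0 : ℤ)) ∉ ladderPlus.S ∧ ((2 : ℤ), (3 : ℤ)) ∈ ladderPlus.S ∧ ((2 : ℤ), (-3 : ℤ)) ∉ ladderPlus.S) ∧
    (((1 : ℤ), (0 : ℤ)) ∉ ladderMinus.S ∧ ((2 : ℤ), (3 : ℤ)) ∉ ladderMinus.S ∧ ((2 : ℤ), (-3 : ℤ)) ∈ ladderMinus.S) := by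
  refine ⟨⟨rfl, ?_, ?_⟩, ?_, ?_, ?_, ?_, ?_⟩
  · simp [trivialMod]
  · simp [trivialMod]
  · simp only [mem_holDS]; omega
  · simp only [mem_antiholDS]; omega
  · simp only [mem_midDS]; omega
  · simp only [mem_ladderPlus]; omega
  · simp only [mem_ladderMinus]; omega

/-- **`H¹(𝔤, 𝔨; U(0)) = 0`** (`J_{0,0}`: `H^q ≠ 0` only for `q = 0, 2, 4`). [cite: BorelWallach2000, VI Thm 4.11 (3)] -/
theorem finrank_relCohomology_one_trivialMod : finrank ℂ (relCohomology ℂ gl3 trivialMod.V kSub 1) = 0 :=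
  trivialMod.finrank_relCohomology_one_eq_zero
    (trivialMod.relCochain_one_eq_bot six_Ktypes.1.2.1 six_Ktypes.1.2.2)

/-- **`H¹(𝔤, 𝔨; D₂) = 0`** (discrete series: `H^q ≠ 0` only for `q = n = 2`). [cite: BorelWallach2000, VI Thm 4.11 (2)] -/
theorem finrank_relCohomology_one_holDS : finrank ℂ (relCohomology ℂ gl3 holDS.V kSub 1) = 0 :=
  holDS.finrank_relCohomology_one_eq_zero (holDS.relCochain_one_eq_bot six_Ktypes.2.1.2.1 six_Ktypes.2.1.2.2)

/-- **`H¹(𝔤, 𝔨; D₀) = 0`**. [cite: BorelWallach2000, VI Thm 4.11 (2)] -/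
theorem finrank_relCohomology_one_antiholDS : finrank ℂ (relCohomology ℂ gl3 antiholDS.V kSub 1) = 0 :=
  antiholDS.finrank_relCohomology_one_eq_zero
    (antiholDS.relCochain_one_eq_bot six_Ktypes.2.2.1.2.1 six_Ktypes.2.2.1.2.2)

/-- **`H¹(𝔤, 𝔨; D₁) = 0`**. [cite: BorelWallach2000, VI Thm 4.11 (2)] -/
theorem finrank_relCohomology_one_midDS : finrank ℂ (relCohomology ℂ gl3 midDS.V kSub 1) = 0 :=
  midDS.finrank_relCohomology_one_eq_zero (midDS.relCochain_one_eq_bot six_Ktypes.2.2.2.1.2.1 six_Ktypes.2.2.2.1.2.2)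

/-- `dim C¹(𝔤, 𝔨; J_{1,0}) = 1` (`𝔭⁺ = V_{2,3}` is the lowest `K`-type of `Z(3)`, `𝔭⁻` does not occur).
[cite: BorelWallach2000, VI Thm 4.11 (11)] -/
theorem finrank_relCochain_one_ladderPlus : finrank ℂ (ladderPlus.relCochain 1) = 1 := by
  rw [finrank_relCochain_one, if_pos six_Ktypes.2.2.2.2.1.2.1, if_neg six_Ktypes.2.2.2.2.1.2.2]

/-- `dim C¹(𝔤, 𝔨; J_{0,1}) = 1`. [cite: BorelWallach2000, VI Thm 4.11 (11)] -/
theorem finrank_relCochain_one_ladderMinus : finrank ℂ (ladderMinus.relCochain 1) = 1 := by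
  rw [finrank_relCochain_one, if_neg six_Ktypes.2.2.2.2.2.2.1, if_pos six_Ktypes.2.2.2.2.2.2.2]

/-- the arrows of `J_{1,0} = Z(3)` at its lowest `K`-type `V_{2,3}`: `A_{2,3} = -1`, `B = C = 0`, `D_{2,3} = 0`
[cite: Kovacevic2021, §3 Thm 3 (b75), §4 (`Z(s)`)] -/
theorem ladderPlus_arrows : ladderPlus.A 2 3 = -1 ∧ ladderPlus.D 2 3 = 0 ∧
    (∀ n m : ℤ, ladderPlus.B n m = 0) ∧ ∀ n m : ℤ, ladderPlus.C n m = 0 := by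
  refine ⟨?_, ?_, fun _ _ => rfl, fun _ _ => rfl⟩
  · show (if (2 : ℤ) ≤ 2 ∧ (3 : ℤ) = 3 * 2 + (-3) then -(2 * ((2 : ℤ) : ℂ) + ((-3 : ℤ) : ℂ) + 1) / 2 else 0) = -1
    rw [if_pos ⟨le_rfl, by norm_num⟩]
    push_cast
    norm_num
  · show (if (2 : ℤ) + 1 ≤ 2 ∧ (3 : ℤ) = 3 * 2 + (-3) then (1 : ℂ) else 0) = 0
    rw [if_neg fun h => absurd h.1 (by norm_num)]

/-- the arrows of `J_{0,1} = Z(-3)` at its lowest `K`-type `V_{2,-3}`: `B_{2,-3} = -1`, `A = D = 0`,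
`C_{2,-3} = 0` [cite: Kovacevic2021, §3 Thm 3 (b80), §4 (`Z(s)`)] -/
theorem ladderMinus_arrows : ladderMinus.B 2 (-3) = -1 ∧ ladderMinus.C 2 (-3) = 0 ∧
    (∀ n m : ℤ, ladderMinus.A n m = 0) ∧ ∀ n m : ℤ, ladderMinus.D n m = 0 := by
  refine ⟨?_, ?_, fun _ _ => rfl, fun _ _ => rfl⟩
  · show (if (2 : ℤ) ≤ 2 ∧ (-3 : ℤ) = -(3 * 2 + (-3)) then -(2 * ((2 : ℤ) : ℂ) + ((-3 : ℤ) : ℂ) + 1) / 2 else 0) = -1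
    rw [if_pos ⟨le_rfl, by norm_num⟩]
    push_cast
    norm_num
  · show (if (2 : ℤ) + 1 ≤ 2 ∧ (-3 : ℤ) = -(3 * 2 + (-3)) then (1 : ℂ) else 0) = 0
    rw [if_neg fun h => absurd h.1 (by norm_num)]

-- one uniform expansion of `(df)(x, y) = x·f(y) - y·f(x) - f([x,y])` on the basis of `V_{2,±3} ⊕ V_{3,±6}`
set_option linter.unusedSimpArgs false in
/-- **Every relative `1`-cochain of `J_{1,0}` is closed.**  Such a cochain is `y ↦ c (y₀₂ u¹_{2,3} - y₁₂ u²_{2,3})`;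
in `(df)(x,y) = x·f(y) - y·f(x) - f([x,y])` the components along `u^k_{3,6}` cancel between the two first terms
and the component along `V_{2,3}` is the `𝔨`-equivariance of `f` (arrows: `A_{2,3} = -1`, `B = C = D = 0` at
`V_{2,3}`). [cite: BorelWallach2000, II Prop. 3.1 (b), VI Thm 4.11 (3)] -/
theorem d_eq_zero_of_mem_relCochain_one_ladderPlus {f : Cochain ℂ gl3 ladderPlus.V 1}
    (hf : f ∈ ladderPlus.relCochain 1) : d ℂ gl3 ladderPlus.V 1 f = 0 := by
  have hw₁ := apply_E02_mem_hwSpace hf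
  have hw₂ := apply_E21_mem_hwSpace hf
  rw [hwSpace_eq_span, Submodule.mem_span_singleton] at hw₁
  rw [hwSpace_eq_span, vec_of_not_mem 1 six_Ktypes.2.2.2.2.1.2.2, Submodule.span_zero_singleton,
    Submodule.mem_bot] at hw₂
  obtain ⟨c, hc⟩ := hw₁
  obtain ⟨hA, hD, hB, hC⟩ := ladderPlus_arrows
  rw [eq_pairCochain hf, ← hc, hw₂]
  refine AlternatingMap.ext fun v => ?_
  rw [cochain_two_apply_eq, d_one_apply, AlternatingMap.zero_apply, pairCochain_apply, pairCochain_apply,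
    pairCochain_apply, Matrix.cons_val_zero, Matrix.cons_val_zero, Matrix.cons_val_zero, pairMap_apply,
    pairMap_apply, pairMap_apply, lie_def, lie_def]
  simp (disch := omega) only [ρfun, map_zero, smul_zero, sub_zero, add_zero, zero_add, LinearMap.add_apply,
    LinearMap.smul_apply, map_add, map_sub, map_smul, map_neg, LieRing.of_associative_ring_bracket,
    Matrix.sub_apply, Matrix.mul_apply, Fin.sum_univ_three, Ha_vec, Hb_vec, Xa_vec, Yb_vec, Xab_vec,
    Ya_vec 2 3 le_rfl, Ya_vec 2 3 (show (1 : ℤ) ≤ 1 + 1 by omega), Xb_vec 2 3 le_rfl,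
    Xb_vec 2 3 (show (1 : ℤ) ≤ 1 + 1 by omega), Yab_vec 2 3 le_rfl, Yab_vec 2 3 (show (1 : ℤ) ≤ 1 + 1 by omega),
    hA, hD, hB, hC, vec_of_not_range, smul_add, smul_sub, smul_neg, smul_smul, neg_zero, Int.cast_add,
    Int.cast_sub, Int.cast_one, Int.cast_ofNat, Int.cast_zero, Int.cast_neg, mul_zero, zero_mul, mul_one,
    neg_neg, add_sub_cancel_right, sub_add_cancel, zero_smul, neg_smul]
  match_scalars <;> ring

-- as above, for `J_{0,1}`
set_option linter.unusedSimpArgs false in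
/-- **Every relative `1`-cochain of `J_{0,1}` is closed** (cochain `y ↦ c (y₂₁ u¹_{2,-3} + y₂₀ u²_{2,-3})`; arrows
`B_{2,-3} = -1`, `A = C = D = 0` at `V_{2,-3}`). [cite: BorelWallach2000, II Prop. 3.1 (b), VI Thm 4.11 (3)] -/
theorem d_eq_zero_of_mem_relCochain_one_ladderMinus {f : Cochain ℂ gl3 ladderMinus.V 1}
    (hf : f ∈ ladderMinus.relCochain 1) : d ℂ gl3 ladderMinus.V 1 f = 0 := by
  have hw₁ := apply_E02_mem_hwSpace hf
  have hw₂ := apply_E21_mem_hwSpace hf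
  rw [hwSpace_eq_span, vec_of_not_mem 1 six_Ktypes.2.2.2.2.2.2.1, Submodule.span_zero_singleton,
    Submodule.mem_bot] at hw₁
  rw [hwSpace_eq_span, Submodule.mem_span_singleton] at hw₂
  obtain ⟨c, hc⟩ := hw₂
  obtain ⟨hB, hC, hA, hD⟩ := ladderMinus_arrows
  rw [eq_pairCochain hf, ← hc, hw₁]
  refine AlternatingMap.ext fun v => ?_
  rw [cochain_two_apply_eq, d_one_apply, AlternatingMap.zero_apply, pairCochain_apply, pairCochain_apply,
    pairCochain_apply, Matrix.cons_val_zero, Matrix.cons_val_zero, Matrix.cons_val_zero, pairMap_apply,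
    pairMap_apply, pairMap_apply, lie_def, lie_def]
  simp (disch := omega) only [ρfun, map_zero, smul_zero, sub_zero, add_zero, zero_add, LinearMap.add_apply,
    LinearMap.smul_apply, map_add, map_sub, map_smul, map_neg, LieRing.of_associative_ring_bracket,
    Matrix.sub_apply, Matrix.mul_apply, Fin.sum_univ_three, Ha_vec, Hb_vec, Xa_vec, Yb_vec, Xab_vec,
    Ya_vec 2 (-3) le_rfl, Ya_vec 2 (-3) (show (1 : ℤ) ≤ 1 + 1 by omega), Xb_vec 2 (-3) le_rfl,
    Xb_vec 2 (-3) (show (1 : ℤ) ≤ 1 + 1 by omega), Yab_vec 2 (-3) le_rfl,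
    Yab_vec 2 (-3) (show (1 : ℤ) ≤ 1 + 1 by omega), hA, hD, hB, hC, vec_of_not_range, smul_add, smul_sub,
    smul_neg, smul_smul, neg_zero, Int.cast_add, Int.cast_sub, Int.cast_one, Int.cast_ofNat, Int.cast_zero,
    Int.cast_neg, mul_zero, zero_mul, mul_one, neg_neg, add_sub_cancel_right, sub_add_cancel, zero_smul, neg_smul]
  match_scalars <;> ring

/-- **`dim H¹(𝔤, 𝔨; J_{1,0}) = 1`** (Borel–Wallach: `H^q(J_{1,0}) = ℂ` for `q = 1, 3`).
[cite: BorelWallach2000, VI Thm 4.11 (3)] [cite: VoganZuckerman1984, Thm 5.5 (rank one)] -/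
theorem finrank_relCohomology_one_ladderPlus : finrank ℂ (relCohomology ℂ gl3 ladderPlus.V kSub 1) = 1 := by
  rw [ladderPlus.finrank_relCohomology_one_eq (ladderPlus.relCochain_zero_eq_bot six_Ktypes.2.2.2.2.1.1)
    (fun f hf => d_eq_zero_of_mem_relCochain_one_ladderPlus hf), finrank_relCochain_one_ladderPlus]

/-- **`dim H¹(𝔤, 𝔨; J_{0,1}) = 1`**. [cite: BorelWallach2000, VI Thm 4.11 (3)] -/
theorem finrank_relCohomology_one_ladderMinus : finrank ℂ (relCohomology ℂ gl3 ladderMinus.V kSub 1) = 1 := by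
  rw [ladderMinus.finrank_relCohomology_one_eq (ladderMinus.relCochain_zero_eq_bot six_Ktypes.2.2.2.2.2.1)
    (fun f hf => d_eq_zero_of_mem_relCochain_one_ladderMinus hf), finrank_relCochain_one_ladderMinus]

/-- **`H⁰ = 0`** for `D₂`, `D₀`, `D₁`, `J_{1,0}`, `J_{0,1}` (no `K`-invariant vectors).
[cite: BorelWallach2000, VI Thm 4.11 (2), (3)] -/
theorem finrank_relCohomology_zero_five :
    finrank ℂ (relCohomology ℂ gl3 holDS.V kSub 0) = 0 ∧ finrank ℂ (relCohomology ℂ gl3 antiholDS.V kSub 0) = 0 ∧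
      finrank ℂ (relCohomology ℂ gl3 midDS.V kSub 0) = 0 ∧ finrank ℂ (relCohomology ℂ gl3 ladderPlus.V kSub 0) = 0 ∧
        finrank ℂ (relCohomology ℂ gl3 ladderMinus.V kSub 0) = 0 :=
  ⟨holDS.finrank_relCohomology_zero_eq_zero (holDS.relCochain_zero_eq_bot six_Ktypes.2.1.1),
    antiholDS.finrank_relCohomology_zero_eq_zero (antiholDS.relCochain_zero_eq_bot six_Ktypes.2.2.1.1),
    midDS.finrank_relCohomology_zero_eq_zero (midDS.relCochain_zero_eq_bot six_Ktypes.2.2.2.1.1),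
    ladderPlus.finrank_relCohomology_zero_eq_zero (ladderPlus.relCochain_zero_eq_bot six_Ktypes.2.2.2.2.1.1),
    ladderMinus.finrank_relCohomology_zero_eq_zero (ladderMinus.relCochain_zero_eq_bot six_Ktypes.2.2.2.2.2.1)⟩

-- uniform expansion of the action of `𝔤𝔩₃` on `u¹_{1,0}` (all eight operators vanish there)
set_option linter.unusedSimpArgs false in
/-- **`dim H⁰(𝔤, 𝔨; U(0)) = 1`**: the trivial module `U(0) = ℂ u¹_{1,0}` is `𝔤`-invariant (all arrows vanish), so
`H⁰ = C⁰ = ℂ`. [cite: BorelWallach2000, VI Thm 4.11 (3) (`J_{0,0}`, `q = 0`)] -/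
theorem finrank_relCohomology_zero_trivialMod : finrank ℂ (relCohomology ℂ gl3 trivialMod.V kSub 0) = 1 := by
  have hA : ∀ a b : ℤ, trivialMod.A a b = 0 := fun _ _ => rfl
  have hB : ∀ a b : ℤ, trivialMod.B a b = 0 := fun _ _ => rfl
  have hC : ∀ a b : ℤ, trivialMod.C a b = 0 := fun _ _ => rfl
  have hD : ∀ a b : ℤ, trivialMod.D a b = 0 := fun _ _ => rfl
  have hd : ∀ f ∈ (Subcomplex.rel ℂ gl3 trivialMod.V kSub).carrier 0, d ℂ gl3 trivialMod.V 0 f = 0 := by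
    intro f hf
    have hv := (trivialMod.mem_relCochain_zero_iff f).1 hf
    rw [hwSpace_eq_span, Submodule.mem_span_singleton] at hv
    obtain ⟨c, hc⟩ := hv
    rw [d_zero_eq_zero_iff]
    intro x v
    rw [show v = ![] from Subsingleton.elim _ _, ← hc, lie_smul, lie_def]
    simp (disch := omega) only [ρfun, LinearMap.add_apply, LinearMap.smul_apply, Ha_vec, Hb_vec, Xa_vec, Yb_vec,
      Xab_vec, Ya_vec 1 0 le_rfl, Xb_vec 1 0 le_rfl, Yab_vec 1 0 le_rfl, hA, hB, hC, hD, vec_of_not_range,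
      smul_zero, smul_smul, zero_smul, add_zero, zero_add, mul_zero, zero_mul, neg_zero, smul_neg, Int.cast_one,
      Int.cast_zero, Int.cast_ofNat]
    match_scalars
    ring
  rw [finrank_cohomology_zero_of_closed (Subcomplex.rel ℂ gl3 trivialMod.V kSub) hd]
  show finrank ℂ (trivialMod.relCochain 0) = 1
  rw [finrank_relCochain_zero, if_pos six_Ktypes.1.1]


end Six

end SU21Datum

end Literature.RepresentationTheory.Kovacevic2021
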